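import Summits.HubbardSuperconductivity.HubbardSuperconductivity.Theses.ParityLeeYang
import Literature.MathematicalPhysics.QuantumLattice.PairFieldEvenSideLRO
import Literature.MathematicalPhysics.QuantumLattice.FinDimSpectrumGibbsLimitProofs
import Literature.MathematicalPhysics.QuantumLattice.HubbardModelGrandCanonicalProofs

/-!
# Birth skeleton (BC3) for crux `ParityLeeYang.ParityBridge` — stmt-HubbardSuperconductivity-8382

Route `route-HubbardSuperconductivity-ParityLeeYang` (sub-problem `HubbardSuperconductivity`), crux of
rank 3, THE COHERENCE HALF of the thesis `ParityPositiveWindow ∧ ParityBridge`: for all `U > 0`,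
`0 < δ₁ < δ₂ < 2/5`, `μ₁ < μ₂`, `β₀ > 0`, the WINDOW DATA of `ParityPositiveWindow` at
`(U, δ₁, δ₂, μ₁, μ₂, β₀)` — for every `β ≥ β₀`, eventually in even `L`, the grand-canonical Gibbs
density of `hubbardTorusWith 2 L 1 U μ₁` is `≤ (1-δ₂)L²`, that of `μ₂` is `≥ (1-δ₁)L²`, and the
parity-twisted partition function `Re Tr[(-1)^N e^{-β(H_L-μN)}]` is `> 0` for every `μ ∈ [μ₁, μ₂]`
— forces `HasDWavePairFieldLROAt U δ` for some `δ ∈ [δ₁, δ₂]` (every normalised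
`(N_L, S^z = 0)`-sector ground-state sequence of the pure torus Hubbard model at hole doping `δ` has
`d_{x²-y²}` pair-field long-range order along even sides).

Registrar seat `planner-skel-stmt-HubbardSuperconductivity-8382-0`, 2026-08-17 (mode
skeleton-register, re-audit bin REPAIRABLE). Published as `Cruxes/ParityBridge/Lines/birth.lean`.

## The cut: THERMODYNAMICS first (cold grand-canonical tori), GROUND STATES last

The route file's own foreseen glued split (TWO-LAYER PLAN: `ParityBridge ⇐ EnsembleDescent →
PairCoherence`) separates the two difficulties its why-might-fail names — "positivity certifies LOCAL
pairing only, not coherence" and "fixed-T grand-canonical data → EVERY sector ground state is an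
unguarded descent". The skeleton registers exactly these two as stubs and PROVES the seam between
them (the zero-temperature limit at fixed volume) and the tail (the summit's `liminf` format):

* `stub_pairCoherence : PairCoherence` — THE PHYSICS (size XL, open; hardest stub). The window data
  force, for some `δ ∈ [δ₁, δ₂]` and some `μ ∈ [μ₁, μ₂]`, COLD GRAND-CANONICAL `d`-WAVE PAIR ORDER AT
  DENSITY `1 - δ` (`ColdPairOrderAt U δ μ`): there are `κ > 0`, `a > 0` such that for all large even
  `L` and ALL inverse temperatures `β ≥ κ log L` the Gibbs state `ω_{β,μ,L}` of
  `hubbardTorusWith 2 L 1 U μ` has density `Re ω(N̂) = (1-δ)L² + o(L²)` and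
  `Re ω(Δ_d† Δ_d) ≥ a L⁴` (`Δ_d = pairField dWaveFormFactor L`). The logarithmic cooling schedule is
  what makes this statement live: at FIXED `β` the `U(1)`-invariant Gibbs state of the
  two-dimensional model has no pair long-range order at all (Koma–Tasaki 1992: the catalogued barriers
  `PositiveTemperatureNoPairLRO` / `HohenbergMerminWagnerPairing`, McBryan–Spencer decay
  `|x|^{-c/β}` summing to `L^{4-c/β} = o(L⁴)`), whereas along `β ≥ κ log L` the same bound reads
  `L⁴ · L^{-c/β} ≥ e^{-c/κ} L⁴` — a phase-stiff paired phase passes, nothing else is excluded for free.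
  Why it might fail = the crux's first clause (a parity-positive compressible window certifies a
  spin/parity gap, not `B₁g` phase coherence: preformed pairs, spin-gapped stripes / PDW, `d_xy`/`p`
  condensates near `n ≈ 0.6`), plus the density clause (the window is swept compressibly, but a
  first-order density jump at the ordering `μ` is not excluded by the hypothesis).
* the SEAM, proved here (`groundPairOrderAt_of_cold`, no `sorry`): at fixed `L` the Gibbs state of
  the Hermitian `H_L - μN` tends to the tracial ground-state functional as `β → ∞`
  (`Matrix.tendsto_gibbsState_atTop_holds`, Tasaki 2020 App. A), so cold order for ALL `β ≥ κ log L`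
  descends to the grand-canonical GROUND MIXTURE at `μ`: `GroundPairOrderAt U δ μ` (density
  `(1-δ)L² + o(L²)` and `Re ω₀(Δ_d† Δ_d) ≥ a L⁴` for the uniform mixture over the ground space of
  `H_L - μN`, eventually in even `L`).
* `stub_ensembleDescent : EnsembleDescent` — THE DESCENT (size L/XL, open). Grand-canonical
  ground-mixture `d`-wave order at `μ` with ground density `→ 1 - δ` forces EVERY admissible
  `(N_L, S^z = 0)`-sector ground-state sequence, `N_L = 2⌊(1-δ)L²/2⌋`, to satisfy
  `c L⁴ ≤ Re ⟨ψ_L, Δ_d† Δ_d ψ_L⟩` eventually in even `L`, for some `c > 0`. Three genuine passages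
  hide in it and nowhere else: ensemble (the GC ground space at `μ` sits at particle numbers
  `N*(μ, L) = (1-δ)L² + o(L²)`, which may differ from `N_L` by `o(L²)` electrons), spin sector (all
  `S^z` in the GC mixture versus `S^z = 0`), and AVERAGE → EVERY (order of the uniform ground mixture
  versus order of each vector of a possibly degenerate multiplet — cf. the sibling cruxes
  `BalabanIR.BirEveryGroundState`, `ThermalWedge.TwSeededEnsembleEquivalence`). Why it might fail:
  a degenerate or quasi-degenerate ground multiplet can fragment `ρ₂` (order in the mixture carried by
  few members), and `o(L²)` added holes could in principle land on a competing (stripe) sector.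
* the TAIL, proved here from landed Literature: `Σ_{x,y} G_L(x,y) = Re ⟨Δ_d† Δ_d⟩`
  (`sum_pairFieldCorr_succ`) and the even-side `liminf` bookkeeping `hasLongRangeOrder_even_of_le`
  (`Literature/…/PairFieldEvenSideLRO.lean`) turn the eventual volume-order bound into
  `HasDWavePairFieldLROAt U δ` in the summit's format.

Composition `ParityBridge_of : S1 → S2 → ParityBridge` (hypotheses spelled `__Registered.stub_X`,
`rfl`-aliases keyed by the stub names, for the native skeleton audit) is proved below WITHOUT
`sorry` and concludes the route decl
`Summit.HubbardSuperconductivity.HubbardSuperconductivity.Theses.ParityLeeYang.ParityBridge` BY NAME.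

## Disproof used / negatives / dead lines

None relevant: `ledger crux ls stmt-HubbardSuperconductivity-8382` showed no workfiles (no
`Disproof.lean`, no `Lines/`, no ideas) on 2026-08-17; no `Theorems/ParityBridge/Negative/`;
`ledger negatives --problem HubbardSuperconductivity` lists two refuted statements (CooperPairDMottWalk
breathing self-duality, AposterioriCapRg KLS order-openness), neither about Gibbs states, pair order
or ensemble descent, and no stub is an instance of either. Rejected cut: a UNIFORM `T = 0` parity /
pair-binding gap as the intermediate — nodal `d`-wave has none, it is route ParityGapRigidity's kill
criterion `NoUniformParityGap` (`Theorems/ParityGapRigidityNoUniformParityGap.lean`), and the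
ParityLeeYang header exists precisely to avoid it ("needs a UNIFORM T = 0 parity gap that nodal
d-wave lacks; here the datum is the SIGN at fixed T").

## References

Koma–Tasaki, PRL 68 (1992) 3248 [KomaTasaki1992]; Tasaki, *Physics and Mathematics of Quantum
Many-Body Systems* (2020) App. A [Tasaki2020]; Bratteli–Robinson II §5.3.1; Scalapino, Phys. Rep.
250 (1995) 329 §2 eq. (2.4) [Scalapino1995]; Tasaki–Watanabe 2021 [TasakiWatanabe2021];
Matveev–Larkin, PRL 78 (1997) 3749 [MatveevLarkin1997]; Janko–Smith–Ambegaokar, PRB 50 (1994) 1152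
[JankoSmithAmbegaokar1994]; Raghu–Kivelson–Scalapino, PRB 81 (2010) 224505 §III.B
[RaghuKivelsonScalapino2010]; Emery–Kivelson, Nature 374 (1995) 434 [EmeryKivelson1995].
-/

-- `Summit.<Summit>.<Problem>` is the tree's mandated summit-side namespace; single-conjunct summit, duplicate deliberate.
set_option linter.dupNamespace false

noncomputable section

namespace Summit.HubbardSuperconductivity.HubbardSuperconductivity.Cruxes.ParityBridge.Birth

open Filter Matrix
open Literature.Probability.LatticeModels
open Literature.MathematicalPhysics.QuantumLattice
open Literature.Barriers.HubbardSuperconductivity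
open scoped ComplexOrder Topology

/-! ## Objects -/

/-- **The window data** of `ParityPositiveWindow` at `(U, δ₁, δ₂, μ₁, μ₂, β₀)` — verbatim the
antecedent of the crux `ParityBridge`: for every `β ≥ β₀`, eventually in even `L`, the Gibbs density
at `μ₁` is `≤ (1-δ₂)L²`, at `μ₂` is `≥ (1-δ₁)L²`, and `Re Tr[(-1)^N e^{-β(H_L-μN)}] > 0` on
`[μ₁, μ₂]`. -/
def WindowData (U δ₁ δ₂ μ₁ μ₂ β₀ : ℝ) : Prop :=
  ∀ β : ℝ, β₀ ≤ β → ∃ L₀ : ℕ, ∀ L : ℕ, Even L → L₀ ≤ L →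
    ((hubbardTorusWith 2 L 1 U μ₁).gibbsState β totalNumber).re ≤ (1 - δ₂) * (L : ℝ) ^ 2 ∧
      (1 - δ₁) * (L : ℝ) ^ 2 ≤ ((hubbardTorusWith 2 L 1 U μ₂).gibbsState β totalNumber).re ∧
        ∀ μ ∈ Set.Icc μ₁ μ₂, 0 < (parityOp * (hubbardTorusWith 2 L 1 U μ).gibbsWeight β).trace.re

/-- **Admissible ground-state sequences at `(U, δ)`** — verbatim the hypothesis of
`HasDWavePairFieldLROAt U δ` (= the summit hypothesis): at every even side, `N_L = 2⌊(1-δ)L²/2⌋`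
electrons, `ψ_L` normalised, `ψ_L` a ground state of `hubbardTorus 2 L 1 U` in the sector
`(N_L, S^z = 0)`. -/
def Admissible (U δ : ℝ) (N : ℕ → ℕ) (ψ : ∀ L : ℕ, Fock (Orb (FermionTorus 2 L))) : Prop :=
  ∀ L, Even L → N L = 2 * ⌊(1 - δ) * (L : ℝ) ^ 2 / 2⌋₊ ∧ star (ψ L) ⬝ᵥ ψ L = 1 ∧
    IsGroundStateInSector (hubbardTorus 2 L 1 U) (N L) 0 (ψ L)

/-- **Cold grand-canonical `d`-wave pair order at density `1 - δ`** (`ColdPairOrderAt U δ μ`, the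
conclusion of S1): there are `κ > 0` and `a > 0` such that, for the Gibbs states
`ω_{β,μ,L} = (hubbardTorusWith 2 L 1 U μ).gibbsState β` along the LOGARITHMIC COOLING `β ≥ κ log L`,
(density) for every `ε > 0`, eventually in even `L`, `|Re ω_{β,μ,L}(N̂)/L² - (1-δ)| ≤ ε` for all
`β ≥ κ log L`; (order) eventually in even `L`, `a L⁴ ≤ Re ω_{β,μ,L}(Δ_d† Δ_d)` for all
`β ≥ κ log L`, `Δ_d = pairField dWaveFormFactor L`. -/
def ColdPairOrderAt (U δ μ : ℝ) : Prop :=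
  ∃ κ a : ℝ, 0 < κ ∧ 0 < a ∧
    (∀ ε : ℝ, 0 < ε → ∀ᶠ L : ℕ in atTop, Even L → ∀ β : ℝ, κ * Real.log L ≤ β →
      |((hubbardTorusWith 2 L 1 U μ).gibbsState β totalNumber).re / (L : ℝ) ^ 2 - (1 - δ)| ≤ ε) ∧
    (∀ᶠ L : ℕ in atTop, ∀ [NeZero L], Even L → ∀ β : ℝ, κ * Real.log L ≤ β →
      a * (L : ℝ) ^ 4 ≤ ((hubbardTorusWith 2 L 1 U μ).gibbsState β
        ((pairField dWaveFormFactor L)ᴴ * pairField dWaveFormFactor L)).re)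

/-- **Grand-canonical ground-mixture `d`-wave pair order at density `1 - δ`**
(`GroundPairOrderAt U δ μ`, the hypothesis of S2): for the tracial ground-state functional
`ω₀ = (hubbardTorusWith 2 L 1 U μ).groundStateFunctional` (uniform mixture over the ground space of
`H_L - μN`), (density) for every `ε > 0`, eventually in even `L`, `|Re ω₀(N̂)/L² - (1-δ)| ≤ ε`;
(order) for some `a > 0`, eventually in even `L`, `a L⁴ ≤ Re ω₀(Δ_d† Δ_d)`. -/
def GroundPairOrderAt (U δ μ : ℝ) : Prop :=
  (∀ ε : ℝ, 0 < ε → ∀ᶠ L : ℕ in atTop, Even L →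
      |((hubbardTorusWith 2 L 1 U μ).groundStateFunctional totalNumber).re / (L : ℝ) ^ 2 - (1 - δ)|
        ≤ ε) ∧
    ∃ a : ℝ, 0 < a ∧ ∀ᶠ L : ℕ in atTop, ∀ [NeZero L], Even L →
      a * (L : ℝ) ^ 4 ≤ ((hubbardTorusWith 2 L 1 U μ).groundStateFunctional
        ((pairField dWaveFormFactor L)ᴴ * pairField dWaveFormFactor L)).re

/-! ## Stub statements -/

/-- **S1 — pair coherence** (the open core). For all `U > 0`, `0 < δ₁ < δ₂ < 2/5`, `μ₁ < μ₂`,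
`β₀ > 0`: the window data force cold grand-canonical `d`-wave pair order at some density
`1 - δ`, `δ ∈ [δ₁, δ₂]`, at some chemical potential `μ ∈ [μ₁, μ₂]` of the window. -/
def PairCoherence : Prop :=
  ∀ (U δ₁ δ₂ μ₁ μ₂ β₀ : ℝ), 0 < U → 0 < δ₁ → δ₁ < δ₂ → δ₂ < 2 / 5 → μ₁ < μ₂ → 0 < β₀ →
    WindowData U δ₁ δ₂ μ₁ μ₂ β₀ →
      ∃ δ ∈ Set.Icc δ₁ δ₂, ∃ μ ∈ Set.Icc μ₁ μ₂, ColdPairOrderAt U δ μ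

/-- **S2 — ensemble descent** (open). For all `U > 0`, `δ ∈ (0, 1/2)` and `μ`: grand-canonical
ground-mixture `d`-wave pair order at `μ` with ground density `→ 1 - δ` forces every admissible
`(N_L, S^z = 0)`-sector ground-state sequence at `(U, δ)` to carry a volume-order `d`-wave pair sum,
`c L⁴ ≤ Re ⟨ψ_L, Δ_d† Δ_d ψ_L⟩` eventually in even `L`, for some `c > 0`. -/
def EnsembleDescent : Prop :=
  ∀ (U δ μ : ℝ), 0 < U → δ ∈ Set.Ioo (0 : ℝ) (1 / 2) → GroundPairOrderAt U δ μ →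
    ∀ (N : ℕ → ℕ) (ψ : ∀ L : ℕ, Fock (Orb (FermionTorus 2 L))), Admissible U δ N ψ →
      ∃ c : ℝ, 0 < c ∧ ∀ᶠ L : ℕ in atTop, ∀ [NeZero L], Even L →
        c * (L : ℝ) ^ 4 ≤
          (expect ((pairField dWaveFormFactor L)ᴴ * pairField dWaveFormFactor L) (ψ L)).re

/-! ## Registered stubs -/

/-- stub S1: the window data force cold grand-canonical `d`-wave pair order (hardest stub; the
physics of the crux). -/
theorem stub_pairCoherence : PairCoherence := by
  sorry

/-- stub S2: grand-canonical ground-mixture pair order descends to every canonical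
`(N_L, S^z = 0)` sector ground state (the crux's "unguarded descent"). -/
theorem stub_ensembleDescent : EnsembleDescent := by
  sorry

/-! ## Name-keyed aliases of the stub statements — the hypotheses of `ParityBridge_of`

The native skeleton audit (`#h21_check_skeleton`) admits a hypothesis of the skeleton theorem only if
its head constant is a registered obligation or is NAMED like a declared stub; `__Registered.stub_X`
is the statement of `stub_X` under that name (device of `Cruxes/FluxBridge/Lines/birth.lean`). Each
alias is `rfl`-equal to its statement. -/
namespace __Registered

/-- Alias of `PairCoherence` keyed by the registered stub name. -/
abbrev stub_pairCoherence : Prop := PairCoherence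
/-- Alias of `EnsembleDescent` keyed by the registered stub name. -/
abbrev stub_ensembleDescent : Prop := EnsembleDescent

end __Registered

/-! ## The seam, proved: zero-temperature limit at fixed volume -/

/-- A two-sided bound that holds for all large `β` passes to the `β → ∞` limit. [folklore] -/
theorem abs_sub_le_of_tendsto {f : ℝ → ℝ} {l t ε β₁ : ℝ}
    (hf : Tendsto f atTop (𝓝 l)) (h : ∀ β : ℝ, β₁ ≤ β → |f β - t| ≤ ε) : |l - t| ≤ ε := by
  have hmem : ∀ᶠ β : ℝ in atTop, f β ∈ Set.Icc (t - ε) (t + ε) :=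
    (eventually_ge_atTop β₁).mono fun β hβ => by
      have := h β hβ
      constructor <;> linarith [abs_sub_le_iff.1 this |>.1, abs_sub_le_iff.1 this |>.2]
  have hl : l ∈ Set.Icc (t - ε) (t + ε) := isClosed_Icc.mem_of_tendsto hf hmem
  rw [abs_sub_le_iff]
  constructor <;> linarith [hl.1, hl.2]

/-- Zero-temperature limit of the real part of a Gibbs expectation of the grand-canonical torus
Hubbard Hamiltonian (Hermitian, on the nonempty occupation-number index type):
`Re ω_{β,μ,L}(A) → Re ω₀(A)` as `β → ∞`. Tasaki (2020) App. A. -/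
theorem tendsto_re_gibbsState_hubbardTorusWith (L : ℕ) (U μ : ℝ)
    (A : Matrix (Finset (Orb (FermionTorus 2 L))) (Finset (Orb (FermionTorus 2 L))) ℂ) :
    Tendsto (fun β : ℝ => ((hubbardTorusWith 2 L 1 U μ).gibbsState β A).re) atTop
      (𝓝 ((hubbardTorusWith 2 L 1 U μ).groundStateFunctional A).re) := by
  have hH : (hubbardTorusWith 2 L 1 U μ).IsHermitian :=
    hubbardTorusWith_isHermitian (hamiltonianWith_isHermitian_and_commute_holds _) 1 U μ
  exact (Complex.continuous_re.tendsto _).comp (Matrix.tendsto_gibbsState_atTop_holds hH A)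

/-- **The seam (proved): cold order for all `β ≥ κ log L` descends to the grand-canonical ground
mixture at fixed `L`.** Both clauses of `ColdPairOrderAt` are closed conditions in the Gibbs
expectation, uniform in `β ≥ κ log L`, so they pass to the `β → ∞` limit
(`tendsto_re_gibbsState_hubbardTorusWith`). -/
theorem groundPairOrderAt_of_cold {U δ μ : ℝ} (h : ColdPairOrderAt U δ μ) :
    GroundPairOrderAt U δ μ := by
  obtain ⟨κ, a, _hκ, ha, hdens, hord⟩ := h
  refine ⟨fun ε hε => ?_, a, ha, ?_⟩
  · filter_upwards [hdens ε hε] with L hL hEven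
    have ht := tendsto_re_gibbsState_hubbardTorusWith L U μ totalNumber
    exact abs_sub_le_of_tendsto (ht.div_const ((L : ℝ) ^ 2)) (hL hEven)
  · filter_upwards [hord] with L hL _inst hEven
    have ht := tendsto_re_gibbsState_hubbardTorusWith L U μ
      ((pairField dWaveFormFactor L)ᴴ * pairField dWaveFormFactor L)
    exact ge_of_tendsto ht ((eventually_ge_atTop (κ * Real.log L)).mono fun β hβ => hL hEven β hβ)

/-! ## Composition: the crux BY NAME from the two stub statements (no `sorry` below) -/

/-- **ParityBridge_of** — pair coherence (S1) × zero-temperature limit (proved seam) × ensemble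
descent (S2) × even-side `liminf` bookkeeping (landed) ⟹ `ParityBridge`. Hypotheses = the two stub
statements under their registered names (`__Registered.stub_X` is `X` by `rfl`); conclusion = the
route decl, by name. -/
theorem ParityBridge_of (hA : __Registered.stub_pairCoherence)
    (hB : __Registered.stub_ensembleDescent) :
    Summit.HubbardSuperconductivity.HubbardSuperconductivity.Theses.ParityLeeYang.ParityBridge := by
  classical
  intro U δ₁ δ₂ μ₁ μ₂ β₀ hU hδ₁ hδ₁₂ hδ₂ hμ hβ₀ hwin
  -- the crux's antecedent IS `WindowData U δ₁ δ₂ μ₁ μ₂ β₀` (verbatim)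
  have hwin' : WindowData U δ₁ δ₂ μ₁ μ₂ β₀ := hwin
  -- (S1) cold grand-canonical pair order at some density `1 - δ` of the window
  obtain ⟨δ, hδ, μ, -, hcold⟩ := hA U δ₁ δ₂ μ₁ μ₂ β₀ hU hδ₁ hδ₁₂ hδ₂ hμ hβ₀ hwin'
  refine ⟨δ, hδ, ?_⟩
  have hδ' : δ ∈ Set.Ioo (0 : ℝ) (1 / 2) :=
    ⟨lt_of_lt_of_le hδ₁ hδ.1, lt_of_le_of_lt hδ.2 (by linarith)⟩
  -- (seam) `β → ∞` at fixed `L`: order of the grand-canonical ground mixture at `μ`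
  have hground : GroundPairOrderAt U δ μ := groundPairOrderAt_of_cold hcold
  -- (S2) every admissible `(N_L, S^z = 0)` ground-state sequence has a volume-order pair sum
  intro N ψ hadm
  have hadm' : Admissible U δ N ψ := hadm
  obtain ⟨c, hc, hev⟩ := hB U δ μ hU hδ' hground N ψ hadm'
  -- (tail) the summit's `liminf` format along the even sides
  obtain ⟨K, hK⟩ := Filter.eventually_atTop.1 hev
  refine hasLongRangeOrder_even_of_le dWaveFormFactor ψ (fun n hn => (hadm' (n + 1) hn).2.1) hc K
    fun n hn hKn => ?_
  rw [sum_pairFieldCorr_succ]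
  exact hK (n + 1) hKn hn

/-- Wiring check (an `example`, so that `ParityBridge_of` stays the only theorem concluding the
crux): the registered stubs feed the skeleton theorem as stated — this term becomes the crux proof
when the two `sorry`s above are discharged. -/
example : Summit.HubbardSuperconductivity.HubbardSuperconductivity.Theses.ParityLeeYang.ParityBridge :=
  ParityBridge_of stub_pairCoherence stub_ensembleDescent

/-- The plain-arrow form `<stub sigs> → ParityBridge` of the skeleton theorem (same proof term). -/
example : PairCoherence → EnsembleDescent →
    Summit.HubbardSuperconductivity.HubbardSuperconductivity.Theses.ParityLeeYang.ParityBridge :=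
  ParityBridge_of

end Summit.HubbardSuperconductivity.HubbardSuperconductivity.Cruxes.ParityBridge.Birth

end
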